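import Literature.GroupTheory.CombinatorialGroupTheory.BinaryProductComponents
import Mathlib.Data.Sym.Sym2
import HarnessLib

/-!
# Edges of the partner graph, crossing edges, the edges of a component

Topic `Literature/GroupTheory/CombinatorialGroupTheory`.  Continuation of
`BinaryProductComponents.lean` (Zieschang–Vogt–Coldewey, *Surfaces and Planar Discontinuous
Groups*, LNM 835 (1980), §5.3, proofs of Thm. 5.3.2 and Lemma 5.3.4).  For a cyclically Nielsen
reduced cyclic product `U` with a pairing `bar` and a **side function** `s : ℕ × ℕ → Bool` on
the slots:

* the pure parity lemma `card_filter_ne_succ_mod_two`: along a sequence of sides the number of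
  sign changes is even iff the two ends agree;
* edges as tagged unordered pairs of slots (`Edge`, `fedge`, `cedge`, `IsEdge`), the crossing
  predicate `IsCrossing s ε` (the two ends lie on different sides), the finite sets `edgesOf`,
  `compEdges` (the edges of a component: exactly the edges with an end in it,
  `mem_compEdges_iff`) and `crossings`; under (P2) a crossing `f`-edge between two kernel slots
  is impossible (`false_of_isCrossing_kernel_pair`);
* the edges `wedge σ₀ j` along the alternating walk from `σ₀` and their sides `wside`: if they
  are pairwise distinct and the walk starts and ends on one side, evenly many of them are
  crossing (`even_card_crossings_image_wedge`).

The enumeration of the edges of a component by its walk, the parity principle and the mate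
lemma follow in `BinaryProductParity.lean`.

## References

* H. Zieschang, E. Vogt, H.-D. Coldewey, *Surfaces and Planar Discontinuous Groups*, LNM 835
  (1980), §5.3 (Thm. 5.3.2, Lemma 5.3.4). [ZieschangVogtColdewey1980]
-/

namespace Literature.GroupTheory.CombinatorialGroupTheory

open List

namespace CycFactors

/-! ## Sign changes along a sequence -/

/-- **Parity of sign changes**: along a sequence of Booleans `x 0, …, x n` the number of indices
`j < n` with `x j ≠ x (j + 1)` is even if `x 0 = x n` and odd otherwise. [folklore] -/
theorem card_filter_ne_succ_mod_two (x : ℕ → Bool) (n : ℕ) :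
    ((Finset.range n).filter fun j => x j ≠ x (j + 1)).card % 2 = if x 0 = x n then 0 else 1 := by
  induction n with
  | zero => simp
  | succ n ih =>
    rw [Finset.range_add_one, Finset.filter_insert]
    by_cases hn : x n ≠ x (n + 1)
    · rw [if_pos hn, Finset.card_insert_of_notMem (by simp)]
      generalize ((Finset.range n).filter fun j => x j ≠ x (j + 1)).card = k at ih ⊢
      revert ih hn
      cases x 0 <;> cases x n <;> cases x (n + 1) <;> simp <;> omega
    · rw [if_neg hn]
      generalize ((Finset.range n).filter fun j => x j ≠ x (j + 1)).card = k at ih ⊢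
      revert ih hn
      cases x 0 <;> cases x n <;> cases x (n + 1) <;> simp

/-- If the two ends of the sequence agree, the number of sign changes is even (in particular a
closed sequence of sides changes side an even number of times). [folklore] -/
theorem even_card_filter_ne_succ (x : ℕ → Bool) {n : ℕ} (hx : x 0 = x n) :
    Even ((Finset.range n).filter fun j => x j ≠ x (j + 1)).card := by
  rw [Nat.even_iff, card_filter_ne_succ_mod_two, if_pos hx]

/-! ## Edges of the partner graph -/

/-- An **edge** of the partner graph: a tag (`true` for an `f`-edge, `false` for a `c`-edge)
and the unordered pair of its end slots.  The tag keeps the `f`-edge and the `c`-edge of a slot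
apart even when its formal and cancelling partners coincide (an inessential symbol).
[cite: ZieschangVogtColdewey1980, proof of Thm. 5.3.2] -/
abbrev Edge : Type := Bool × Sym2 (ℕ × ℕ)

variable {α : Type*}

/-- The `f`-edge at a slot: `{σ, fpartner σ}`. [cite: ZieschangVogtColdewey1980, proof of Thm. 5.3.2] -/
def fedge (U : List (List (α × Bool))) (bar : ℕ → ℕ) (σ : ℕ × ℕ) : Edge :=
  (true, s(σ, fpartner U bar σ))

variable [DecidableEq α]

/-- The `c`-edge at a head or tail slot: `{σ, cget σ}` (a cancelling pair).
[cite: ZieschangVogtColdewey1980, proof of Thm. 5.3.2] -/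
def cedge (U : List (List (α × Bool))) (σ : ℕ × ℕ) : Edge := (false, s(σ, cget U σ))

/-- The edges of the partner graph: the `f`-edges of all slots and the `c`-edges of the head and
tail slots. [cite: ZieschangVogtColdewey1980, proof of Thm. 5.3.2] -/
def IsEdge (U : List (List (α × Bool))) (bar : ℕ → ℕ) (ε : Edge) : Prop :=
  ∃ σ, IsSlot U σ ∧ (ε = fedge U bar σ ∨ (¬ IsKernelSlot U σ ∧ ε = cedge U σ))

omit [DecidableEq α] in
/-- A **crossing** edge for a side function `s`: its two ends lie on different sides.
[cite: ZieschangVogtColdewey1980, proof of Lemma 5.3.4] -/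
def IsCrossing (s : ℕ × ℕ → Bool) (ε : Edge) : Prop := ¬ (ε.2.map s).IsDiag

variable {U : List (List (α × Bool))} {bar : ℕ → ℕ} {s : ℕ × ℕ → Bool} {σ τ ρ ρ' : ℕ × ℕ} {ε : Edge}

omit [DecidableEq α] in
/-- Crossing, explicitly. [folklore] -/
@[simp] theorem isCrossing_mk {b : Bool} {σ τ : ℕ × ℕ} : IsCrossing s (b, s(σ, τ)) ↔ s σ ≠ s τ := by
  change ¬ (s(s σ, s τ)).IsDiag ↔ _
  rw [Sym2.mk_isDiag_iff]

omit [DecidableEq α] in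
/-- An `f`-edge is crossing iff the slot and its formal partner lie on different sides. [folklore] -/
theorem isCrossing_fedge : IsCrossing s (fedge U bar σ) ↔ s σ ≠ s (fpartner U bar σ) := isCrossing_mk

/-- A `c`-edge is crossing iff the slot and its cancelling partner lie on different sides. [folklore] -/
theorem isCrossing_cedge : IsCrossing s (cedge U σ) ↔ s σ ≠ s (cget U σ) := isCrossing_mk

omit [DecidableEq α] in
/-- A crossing edge has two ends on different sides. [folklore] -/
theorem IsCrossing.exists_mem (hc : IsCrossing s ε) : ∃ ρ ∈ ε.2, ∃ ρ' ∈ ε.2, s ρ ≠ s ρ' := by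
  obtain ⟨b, e⟩ := ε
  induction e using Sym2.ind with
  | _ x y => exact ⟨x, Sym2.mem_mk_left _ _, y, Sym2.mem_mk_right _ _, isCrossing_mk.1 hc⟩

omit [DecidableEq α] in
/-- An edge with two ends on different sides is crossing. [folklore] -/
theorem isCrossing_of_mem (hρ : ρ ∈ ε.2) (hρ' : ρ' ∈ ε.2) (hne : s ρ ≠ s ρ') : IsCrossing s ε := by
  obtain ⟨b, e⟩ := ε
  induction e using Sym2.ind with
  | _ x y =>
    rw [isCrossing_mk]
    simp only [Sym2.mem_iff] at hρ hρ'
    rcases hρ with rfl | rfl <;> rcases hρ' with rfl | rfl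
    · exact absurd rfl hne
    · exact hne
    · exact hne.symm
    · exact absurd rfl hne

omit [DecidableEq α] in
/-- The ends of an `f`-edge. [folklore] -/
theorem mem_fedge : ρ ∈ (fedge U bar σ).2 ↔ ρ = σ ∨ ρ = fpartner U bar σ := Sym2.mem_iff

/-- The ends of a `c`-edge. [folklore] -/
theorem mem_cedge : ρ ∈ (cedge U σ).2 ↔ ρ = σ ∨ ρ = cget U σ := Sym2.mem_iff

/-- `f`-edges and `c`-edges are different edges. [folklore] -/
theorem fedge_ne_cedge : fedge U bar σ ≠ cedge U τ := fun he => Bool.noConfusion (congrArg Prod.fst he)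

omit [DecidableEq α] in
/-- The `f`-edge at the formal partner is the same edge. [folklore] -/
theorem fedge_fpartner (hb : IsPairing U bar) (hσ : IsSlot U σ) :
    fedge U bar (fpartner U bar σ) = fedge U bar σ := by
  rw [fedge, fedge, hb.fpartner_fpartner hσ, Sym2.eq_swap]

/-- The `c`-edge at the cancelling partner is the same edge. [folklore] -/
theorem cedge_cget (h : CycNielsen U) (hU : U ≠ []) (hσ : IsSlot U σ) (hk : ¬ IsKernelSlot U σ) :
    cedge U (cget U σ) = cedge U σ := by
  rw [cedge, cedge, (h.cget_spec hU hσ hk).2.2, Sym2.eq_swap]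

omit [DecidableEq α] in
/-- When two `f`-edges coincide. [folklore] -/
theorem fedge_eq_fedge_iff (hb : IsPairing U bar) (hσ : IsSlot U σ) :
    fedge U bar σ = fedge U bar τ ↔ τ = σ ∨ τ = fpartner U bar σ := by
  simp only [fedge, Prod.mk.injEq, true_and, Sym2.eq_iff]
  constructor
  · rintro (⟨rfl, -⟩ | ⟨-, h2⟩)
    · exact Or.inl rfl
    · exact Or.inr h2.symm
  · rintro (rfl | rfl)
    · exact Or.inl ⟨rfl, rfl⟩
    · exact Or.inr ⟨(hb.fpartner_fpartner hσ).symm, rfl⟩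

/-- When two `c`-edges coincide. [folklore] -/
theorem cedge_eq_cedge_iff (h : CycNielsen U) (hU : U ≠ []) (hσ : IsSlot U σ) (hk : ¬ IsKernelSlot U σ) :
    cedge U σ = cedge U τ ↔ τ = σ ∨ τ = cget U σ := by
  simp only [cedge, Prod.mk.injEq, true_and, Sym2.eq_iff]
  constructor
  · rintro (⟨rfl, -⟩ | ⟨-, h2⟩)
    · exact Or.inl rfl
    · exact Or.inr h2.symm
  · rintro (rfl | rfl)
    · exact Or.inl ⟨rfl, rfl⟩
    · exact Or.inr ⟨(h.cget_spec hU hσ hk).2.2.symm, rfl⟩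

/-- `f`-edges are edges. [folklore] -/
theorem isEdge_fedge (hσ : IsSlot U σ) : IsEdge U bar (fedge U bar σ) := ⟨σ, hσ, Or.inl rfl⟩

/-- `c`-edges of head and tail slots are edges. [folklore] -/
theorem isEdge_cedge (hσ : IsSlot U σ) (hk : ¬ IsKernelSlot U σ) : IsEdge U bar (cedge U σ) :=
  ⟨σ, hσ, Or.inr ⟨hk, rfl⟩⟩

/-- The two ends of an edge are equal or adjacent. [folklore] -/
theorem IsEdge.eq_or_adj (h : CycNielsen U) (hU : U ≠ []) (hb : IsPairing U bar)
    (hε : IsEdge U bar ε) (hρ : ρ ∈ ε.2) (hρ' : ρ' ∈ ε.2) : ρ = ρ' ∨ Adj U bar ρ ρ' := by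
  obtain ⟨σ, hσ, rfl | ⟨hk, rfl⟩⟩ := hε
  · rw [mem_fedge] at hρ hρ'
    rcases hρ with rfl | rfl <;> rcases hρ' with rfl | rfl
    · exact Or.inl rfl
    · exact Or.inr (adj_fpartner hσ)
    · exact Or.inr ((adj_fpartner hσ).symm h hU hb)
    · exact Or.inl rfl
  · rw [mem_cedge] at hρ hρ'
    rcases hρ with rfl | rfl <;> rcases hρ' with rfl | rfl
    · exact Or.inl rfl
    · exact Or.inr (adj_cget hσ hk)
    · exact Or.inr ((adj_cget hσ hk).symm h hU hb)
    · exact Or.inl rfl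

/-- **The two ends of an edge are on the same component.** [folklore] -/
theorem IsEdge.sameComp (h : CycNielsen U) (hU : U ≠ []) (hb : IsPairing U bar)
    (hε : IsEdge U bar ε) (hρ : ρ ∈ ε.2) (hρ' : ρ' ∈ ε.2) : SameComp U bar ρ ρ' := by
  rcases hε.eq_or_adj h hU hb hρ hρ' with rfl | ha
  · exact sameComp_refl _
  · exact ha.sameComp

/-- The ends of an edge are slots. [folklore] -/
theorem IsEdge.isSlot_of_mem (h : CycNielsen U) (hU : U ≠ []) (hb : IsPairing U bar)
    (hε : IsEdge U bar ε) (hρ : ρ ∈ ε.2) : IsSlot U ρ := by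
  obtain ⟨σ, hσ, rfl | ⟨hk, rfl⟩⟩ := hε
  · rcases mem_fedge.1 hρ with rfl | rfl
    · exact hσ
    · exact hb.isSlot_fpartner hσ
  · rcases mem_cedge.1 hρ with rfl | rfl
    · exact hσ
    · exact (h.cget_spec hU hσ hk).1

/-- **The two ends of an edge have the same level.** [cite: ZieschangVogtColdewey1980, proof of Thm. 5.3.2] -/
theorem IsEdge.level_eq (h : CycNielsen U) (hU : U ≠ []) (hb : IsPairing U bar)
    (hε : IsEdge U bar ε) (hρ : ρ ∈ ε.2) (hρ' : ρ' ∈ ε.2) : level U ρ' = level U ρ :=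
  (hε.sameComp h hU hb hρ hρ').level_eq h hU hb

/-- An edge has a head or tail slot among its ends, unless it is the `f`-edge between two kernel
slots. [folklore] -/
theorem IsEdge.exists_not_isKernelSlot_or (hb : IsPairing U bar) (hε : IsEdge U bar ε) :
    (∃ ρ ∈ ε.2, IsSlot U ρ ∧ ¬ IsKernelSlot U ρ) ∨
      ∃ κ, IsKernelSlot U κ ∧ IsKernelSlot U (fpartner U bar κ) ∧ ε = fedge U bar κ := by
  obtain ⟨σ, hσ, rfl | ⟨hk, rfl⟩⟩ := hε
  · by_cases h1 : IsKernelSlot U σ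
    · by_cases h2 : IsKernelSlot U (fpartner U bar σ)
      · exact Or.inr ⟨σ, h1, h2, rfl⟩
      · exact Or.inl ⟨_, mem_fedge.2 (Or.inr rfl), hb.isSlot_fpartner hσ, h2⟩
    · exact Or.inl ⟨σ, mem_fedge.2 (Or.inl rfl), hσ, h1⟩
  · exact Or.inl ⟨σ, mem_cedge.2 (Or.inl rfl), hσ, hk⟩

/-- **(P2) forbids a crossing `f`-edge between two kernel slots**: such an edge is a whole chain
`[κ, fpartner κ]` with its two ends on different sides.
[cite: ZieschangVogtColdewey1980, proof of Lemma 5.3.4] -/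
theorem false_of_isCrossing_kernel_pair (hP2 : ∀ κ, IsKernelSlot U κ → s κ = s (chainEnd U bar κ))
    {κ : ℕ × ℕ} (hκ : IsKernelSlot U κ) (hκ' : IsKernelSlot U (fpartner U bar κ))
    (hc : s κ ≠ s (fpartner U bar κ)) : False :=
  hc (by rw [hP2 κ hκ, chainEnd_eq_fpartner hκ'])

/-- Under (P2) every crossing edge has a head or tail slot among its ends. [folklore] -/
theorem IsEdge.exists_not_isKernelSlot_of_isCrossing (hb : IsPairing U bar)
    (hP2 : ∀ κ, IsKernelSlot U κ → s κ = s (chainEnd U bar κ)) (hε : IsEdge U bar ε)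
    (hc : IsCrossing s ε) : ∃ ρ ∈ ε.2, IsSlot U ρ ∧ ¬ IsKernelSlot U ρ := by
  rcases hε.exists_not_isKernelSlot_or hb with h1 | ⟨κ, hκ, hκ', rfl⟩
  · exact h1
  · exact (false_of_isCrossing_kernel_pair hP2 hκ hκ' (isCrossing_fedge.1 hc)).elim

/-! ## Edges of a component -/

open Classical in
/-- The edges of the partner graph at the slots of `C`. [folklore] -/
noncomputable def edgesOf (U : List (List (α × Bool))) (bar : ℕ → ℕ) (C : Finset (ℕ × ℕ)) :
    Finset Edge :=
  C.image (fedge U bar) ∪ (C.filter fun σ => ¬ IsKernelSlot U σ).image (cedge U)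

/-- **The edges of the component** of `σ`. [cite: ZieschangVogtColdewey1980, proof of Thm. 5.3.2] -/
noncomputable def compEdges (U : List (List (α × Bool))) (bar : ℕ → ℕ) (σ : ℕ × ℕ) : Finset Edge :=
  edgesOf U bar (comp U bar σ)

omit [DecidableEq α] in
open Classical in
/-- The crossing edges among a finite set of edges. [folklore] -/
noncomputable def crossings (s : ℕ × ℕ → Bool) (E : Finset Edge) : Finset Edge :=
  E.filter (IsCrossing s)

omit [DecidableEq α] in
/-- Membership in `crossings`. [folklore] -/
theorem mem_crossings {E : Finset Edge} : ε ∈ crossings s E ↔ ε ∈ E ∧ IsCrossing s ε := by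
  simp only [crossings, Finset.mem_filter]

/-- Membership in `edgesOf`. [folklore] -/
theorem mem_edgesOf {C : Finset (ℕ × ℕ)} : ε ∈ edgesOf U bar C ↔
    ∃ σ ∈ C, ε = fedge U bar σ ∨ (¬ IsKernelSlot U σ ∧ ε = cedge U σ) := by
  simp only [edgesOf, Finset.mem_union, Finset.mem_image, Finset.mem_filter]
  constructor
  · rintro (⟨σ, hσ, rfl⟩ | ⟨σ, ⟨hσ, hk⟩, rfl⟩)
    · exact ⟨σ, hσ, Or.inl rfl⟩
    · exact ⟨σ, hσ, Or.inr ⟨hk, rfl⟩⟩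
  · rintro ⟨σ, hσ, rfl | ⟨hk, rfl⟩⟩
    · exact Or.inl ⟨σ, hσ, rfl⟩
    · exact Or.inr ⟨σ, ⟨hσ, hk⟩, rfl⟩

/-- The `f`-edge of a member of the component is an edge of the component. [folklore] -/
theorem fedge_mem_compEdges (hτ : τ ∈ comp U bar σ) : fedge U bar τ ∈ compEdges U bar σ :=
  mem_edgesOf.2 ⟨τ, hτ, Or.inl rfl⟩

/-- The `c`-edge of a head or tail member of the component is an edge of the component. [folklore] -/
theorem cedge_mem_compEdges (hτ : τ ∈ comp U bar σ) (hk : ¬ IsKernelSlot U τ) :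
    cedge U τ ∈ compEdges U bar σ :=
  mem_edgesOf.2 ⟨τ, hτ, Or.inr ⟨hk, rfl⟩⟩

/-- **The edges of a component are the edges with an end in it.** [folklore] -/
theorem mem_compEdges_iff (h : CycNielsen U) (hU : U ≠ []) (hb : IsPairing U bar) :
    ε ∈ compEdges U bar σ ↔ IsEdge U bar ε ∧ ∃ ρ ∈ ε.2, ρ ∈ comp U bar σ := by
  rw [compEdges, mem_edgesOf]
  constructor
  · rintro ⟨τ, hτ, rfl | ⟨hk, rfl⟩⟩
    · exact ⟨isEdge_fedge (isSlot_of_mem_comp hτ), τ, mem_fedge.2 (Or.inl rfl), hτ⟩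
    · exact ⟨isEdge_cedge (isSlot_of_mem_comp hτ) hk, τ, mem_cedge.2 (Or.inl rfl), hτ⟩
  · rintro ⟨⟨τ, hτ, rfl | ⟨hk, rfl⟩⟩, ρ, hρ, hmem⟩
    · refine ⟨τ, ?_, Or.inl rfl⟩
      rcases mem_fedge.1 hρ with rfl | rfl
      · exact hmem
      · exact (fpartner_mem_comp_iff hb hτ).1 hmem
    · refine ⟨τ, ?_, Or.inr ⟨hk, rfl⟩⟩
      rcases mem_cedge.1 hρ with rfl | rfl
      · exact hmem
      · exact (cget_mem_comp_iff h hU hτ hk).1 hmem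

/-- The edges of a component have both ends in it. [folklore] -/
theorem mem_comp_of_mem_compEdges (h : CycNielsen U) (hU : U ≠ []) (hb : IsPairing U bar)
    (hε : ε ∈ compEdges U bar σ) (hρ : ρ ∈ ε.2) : ρ ∈ comp U bar σ := by
  obtain ⟨hε', ρ', hρ', hmem⟩ := (mem_compEdges_iff h hU hb).1 hε
  rw [mem_comp] at hmem ⊢
  exact ⟨hε'.isSlot_of_mem h hU hb hρ, hmem.2.trans (hε'.sameComp h hU hb hρ' hρ)⟩

/-- Members of one component have the same component edges. [folklore] -/
theorem compEdges_eq_of_mem_comp (h : CycNielsen U) (hU : U ≠ []) (hb : IsPairing U bar)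
    (hτ : τ ∈ comp U bar σ) : compEdges U bar τ = compEdges U bar σ := by
  rw [compEdges, compEdges, comp_eq_of_mem h hU hb hτ]

/-- An edge belongs to the component edges of each of its ends. [folklore] -/
theorem IsEdge.mem_compEdges (h : CycNielsen U) (hU : U ≠ []) (hb : IsPairing U bar)
    (hε : IsEdge U bar ε) (hρ : ρ ∈ ε.2) : ε ∈ compEdges U bar ρ :=
  (mem_compEdges_iff h hU hb).2 ⟨hε, ρ, hρ, mem_comp_self (hε.isSlot_of_mem h hU hb hρ)⟩

/-! ## The edges along an alternating walk -/

/-- The `j`-th edge of the alternating walk `σ₀, f σ₀, c f σ₀, …`: the `f`-edge at `(c f)^i σ₀`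
for `j = 2 i`, the `c`-edge at `f ((c f)^i σ₀)` for `j = 2 i + 1`. [folklore] -/
def wedge (U : List (List (α × Bool))) (bar : ℕ → ℕ) (σ₀ : ℕ × ℕ) (j : ℕ) : Edge :=
  if j % 2 = 0 then fedge U bar (citer U bar σ₀ (j / 2))
  else cedge U (fpartner U bar (citer U bar σ₀ (j / 2)))

/-- The side of the `j`-th vertex of the alternating walk from `σ₀`. [folklore] -/
def wside (U : List (List (α × Bool))) (bar : ℕ → ℕ) (s : ℕ × ℕ → Bool) (σ₀ : ℕ × ℕ) (j : ℕ) : Bool :=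
  if j % 2 = 0 then s (citer U bar σ₀ (j / 2)) else s (fpartner U bar (citer U bar σ₀ (j / 2)))

variable {σ₀ : ℕ × ℕ}

/-- Even walk edges are `f`-edges. [folklore] -/
theorem wedge_even (i : ℕ) : wedge U bar σ₀ (2 * i) = fedge U bar (citer U bar σ₀ i) := by
  rw [wedge, if_pos (Nat.mul_mod_right 2 i), Nat.mul_div_cancel_left _ Nat.two_pos]

/-- Odd walk edges are `c`-edges. [folklore] -/
theorem wedge_odd (i : ℕ) : wedge U bar σ₀ (2 * i + 1) = cedge U (fpartner U bar (citer U bar σ₀ i)) := by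
  rw [wedge, if_neg (by omega), show (2 * i + 1) / 2 = i by omega]

/-- Even walk vertices. [folklore] -/
theorem wside_even (i : ℕ) : wside U bar s σ₀ (2 * i) = s (citer U bar σ₀ i) := by
  rw [wside, if_pos (Nat.mul_mod_right 2 i), Nat.mul_div_cancel_left _ Nat.two_pos]

/-- Odd walk vertices. [folklore] -/
theorem wside_odd (i : ℕ) : wside U bar s σ₀ (2 * i + 1) = s (fpartner U bar (citer U bar σ₀ i)) := by
  rw [wside, if_neg (by omega), show (2 * i + 1) / 2 = i by omega]

/-- The walk starts on the side of `σ₀`. [folklore] -/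
theorem wside_zero : wside U bar s σ₀ 0 = s σ₀ := by
  rw [← Nat.mul_zero 2, wside_even, citer_zero]

/-- **A walk edge is crossing iff the walk changes side across it.** [folklore] -/
theorem isCrossing_wedge_iff (j : ℕ) :
    IsCrossing s (wedge U bar σ₀ j) ↔ wside U bar s σ₀ j ≠ wside U bar s σ₀ (j + 1) := by
  rcases Nat.even_or_odd j with ⟨i, rfl⟩ | ⟨i, rfl⟩
  · rw [← two_mul, wedge_even, isCrossing_fedge, wside_even, wside_odd]
  · rw [wedge_odd, isCrossing_cedge, wside_odd, show 2 * i + 1 + 1 = 2 * (i + 1) by ring,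
      wside_even, citer_succ]

/-- **Parity along a walk**: if the walk edges `wedge σ₀ j`, `j < N`, are pairwise distinct and
the walk is on the same side at its vertices `0` and `N`, then evenly many of these edges are
crossing. [cite: ZieschangVogtColdewey1980, proof of Lemma 5.3.4] -/
theorem even_card_crossings_image_wedge {N : ℕ}
    (hinj : Set.InjOn (wedge U bar σ₀) (Finset.range N))
    (hends : wside U bar s σ₀ 0 = wside U bar s σ₀ N) :
    Even (crossings s ((Finset.range N).image (wedge U bar σ₀))).card := by
  classical
  have e1 : crossings s ((Finset.range N).image (wedge U bar σ₀)) =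
      ((Finset.range N).filter fun j => wside U bar s σ₀ j ≠ wside U bar s σ₀ (j + 1)).image
        (wedge U bar σ₀) := by
    rw [crossings, Finset.filter_image]
    congr 1
    exact Finset.filter_congr fun j _ => isCrossing_wedge_iff j
  rw [e1, Finset.card_image_of_injOn (hinj.mono (Finset.coe_subset.2 (Finset.filter_subset _ _)))]
  exact even_card_filter_ne_succ _ hends

end CycFactors

end Literature.GroupTheory.CombinatorialGroupTheory
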